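import Summits.ResolutionOfSingularities.ResolutionOfSingularities.Theorems.KeyChainCut
import Literature.AlgebraicGeometry.Resolution.LocalEtaleUniformization
import HarnessLib

/-!
# HenselKeyChainLU — decomp-res node «HenselLadder» (lens-1 g22), tree companion
Content VERBATIM from the decomp-res lens-1 g22 node `HOME/decomp-res-lens-1/g22/HenselLadder.lean` re-namespaced
`…Theorems.HenselKeyChainLU` (HOME = run/shared/lean/pub/decomp-res; its one global linter option dropped), typed against the
LANDED `Theorems.KeyChainCut` (g21, PART VII) and `Literature…LocalEtaleUniformization`; nothing inlined; a pure addition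
(no existing file touched).  Landing target:
`Summits/ResolutionOfSingularities/ResolutionOfSingularities/Theorems/HenselKeyChainLU.lean`
(`--kind proof --supports stmt-ResolutionOfSingularities-0641`, HELPER file of the host route `Valuative`).
ROOT (verbatim target of the cell): `_root_.ResolutionOfSingularities`.  SPINE: the lens-1 valuative spine as
LANDED in the tree (`Theorems.KeyChainCut`): modulo the Cossart–Piltant floor, CJS-2020, the KK05 (NC)+(V)
ascent `Π₁` and the patching crux `Valuative.PatchingRel` (item 0642) the root is EQUIVALENT
(`root_iff_key_sigma`) to the located residual family `∀ d ≥ 4, NonKHToricArchLUKey 3 3 d` = relative local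
uniformization of the rank-one, zero-dimensional, non-Abhyankar places of transcendence degree `≤ d` that are
not separably dense below, not toric-dense, carry no Kaplansky–Hensel top over a base of transcendence degree
`≤ 3` and NO inductive binomial key chain over a monomial `3`-frame (`¬ KeyChainTopBelow`, g21).  By THEOREM D
(g21 ADDENDUM, accepted CRITIC-LEDGER row 163a) that residual is, on paper, the class
(a′) «no monomially-rational presentation» ∪ (c) «residue field ≠ k».
THESIS OF THIS NODE (window item (K-a′) of row 163a).  Grade the class (a′) by the HENSELIAN INDEX over key-chain
sub-tops, `ι(K, O) := min { [K^h : F₁^h] : F₁ ⊆ K a key-chain sub-top, K | F₁ algebraic }` (`^h` = henselisation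
inside a fixed henselisation of `(K, O)`).  The rung `ι = 1` — `K` lies INSIDE THE HENSELISATION of a key-chain
sub-top, i.e. `K = F₁(η)` with `η` a HENSEL ROOT (simple root of a monic polynomial over `O ∩ F₁` whose
derivative at `η` is a unit) — is the typed cell `HenselKeyChainTopBelow` (PART II) and is DECIDED IN THE KERNEL
by the law `relLU_of_henselKeyChainTop` (PART II), an instance of the ENGINE `relLU_of_henselTop` (PART I):
RelLU of a finitely generated sub-top `F₁` + a Hensel root generating `K` over `F₁` ⇒ RelLU of `K`.  The engine
is Knaf–Kuhlmann 2009 Lemma 3.7 + Prop. 3.5/Cor. 3.6 (tree: `isSmoothlyUniformizableIn_of_henselRoot`,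
`stub_relLU_of_regularBase`) over the REGULAR BUT NON-MONOMIAL base produced by `regularBase_of_relLU` from
the g21 law `relLU_of_keyChainTop`.  NEW PROOF STEP (named, as the window requires): the KK09 FINITE (étale)
STEP over a key-chain top — the first law on this spine whose base is no longer a monomial / toric chart and
whose top is a genuinely TWO-LEVEL field `K = k(y)(z)[w]/(f)`.
THE CUT (PART III, kernel, excluded middle): `NonKHToricArchLUKey e c n ↔ NonKHToricArchLUKeyHensel e c n`
(`nonKHToricArchLUKey_iff_hensel`), the new located residual accumulating `¬ KeyChainTopBelow k O` AND
`¬ HenselKeyChainTopBelow k O`; cell piece `NonKHToricArchLUKeyHenselCell e c n` is a THEOREM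
(`nonKHToricArchLUKeyHenselCell_holds`); both `W`-halves re-located (`…WZeroKeyHensel`, `…WPosKeyHensel`);
ROOT BY NAME `closes_hensel` / `closes_whensel`; `root_iff_hensel_sigma`.  PART IIb (kernel): the ÉTALE
ARTIN–SCHREIER sub-family (`η ^ p - η = a`, `a ∈ O ∩ F₁`) lies in the cell — `henselKeyChainTopBelow_of_artinSchreier`,
`relLU_of_artinSchreier_keyChainTop` — and Kuhlmann's AS trichotomy (étale / defectless-wild / DEFECT) says where
the defect sits in the new residual.

TARGET ⟸ PIECES (tags):
* `CossartPiltant2019LU3` — COSTUME(cite) [CossartPiltant2019];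
* `CossartJannsenSaito2020Embedded` — COSTUME(cite) [CJS2020, tree named fact];
* `KK05NCVAscent` (Π₁) — UNDECIDED · ATTACKABLE (port of [KnafKuhlmann2005, Thm 1.1 (NC)+(V)]);
* `NonKHToricArchLUKeyHenselCell 3 3 d` — DECIDED (kernel theorem, this file) · WEAKER;
* `∀ d ≥ 4, NonKHToricArchLUKeyHensel 3 3 d` — UNDECIDED · WEAKER (`nonKHToricArchLUKeyHensel_of_root`) ·
  leaves: TAME rung `1 < ι, p ∤ ι` ATTACKABLE (PROPOSITION K of NODE-g22.md: exact frame-monomial radicands are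
  re-absorbed into a key-chain frame by Smith normal form; general tame = Abhyankar-lemma step over a key-chain
  base), WILD CORE `p ∣ ι` (wild ramification and, above all, DEFECT `d > 1` over a non-monomial base; Temkin
  inseparable LU, Novacoski–Spivakovsky limit keys, San Saturnino Thm 7.1) IDEA-NEEDED / BARRIER
  (`Literature.Barriers`: none catalogued for this class; the defect is the known obstruction [Kuhlmann2010]),
  direction (c) infinite residue growth IDEA-NEEDED;
* `Valuative.PatchingRel` (item 0642) — UNDECIDED (host route).

INHABITANT OF THE DECIDED CELL, CERTIFIED OFF THE ONE-LEVEL CELL (paper, NODE-g22.md §3): over the I3_ℓ top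
`F₁ = k(x₁, x₂, x₃, x₄) ⊂ Ω = k̄((t^ℝ))` of g20 §32 (`x₁ = t, x₂ = t^√2, x₃ = t^√3`, `x₄ = Σ_j t^{ε_j}`,
`ε_j = N_j + d_j/ℓ^j ↑ ∞`, `ℓ ≠ p`; `Γ_{F₁} = ℤ[1/ℓ](ℤ + ℤ√2 + ℤ√3)`, residue field `k`; `F₁ ∈ KeyChainTopBelow` by
g21 NODE §3(A), critic-re-derived — or the I3 top, `ℓ = p`, by THEOREM D) take `K = F₁(η) ⊂ Ω`,
`η = −Σ_{i≥0} x₁^{m p^i}`, so `η^p − η = x₁^m`, with `m ≥ 2`, `p ∤ m`, `(p−1)(m−1) ≥ 2`, and `O = K ∩ Ω⁺`: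
`f = X^p − X − x₁^m` is irreducible over `F₁` (`x₁^m ∉ ℘(k(x₁,…,x₄))` by degrees), monic over `O ∩ F₁` with
`f′ ≡ −1`, so the Hensel datum holds (kernel: `henselKeyChainTopBelow_of_artinSchreier`); `f̄ = X^p − X` splits
separably, so the `p` extensions of `v|F₁` have `e = f = d = 1`, `Γ_K = Γ_{F₁}` (ℓ-divisible, not finitely generated ⇒
non-Abhyankar, neither sep-dense nor toric-dense below, no KH top over trdeg `≤ 3`, VERBATIM g20 §32(b)) and
`κ_K = k`; and `K ⊇ k(x₁, η)` = the function field of the Artin–Schreier curve `w^p − w = y^m`, of genus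
`(p−1)(m−1)/2 ≥ 1` over `k̄` [Stichtenoth 1993, Prop. 3.7.8(d)], so by the generalised Lüroth theorem (Gordan–Igusa:
a subfield of transcendence degree one of `k(t₁,…,t_n)` is `k(u)`) `K` is NOT purely transcendental over `k` —
hence admits NO key chain (`IsKeyChain.algInd ∧ adjoin_eq_top` make `K = k(g₀,…,g₃)` purely transcendental):
`K ∉ KeyChainTopBelow`, `K ∈ HenselKeyChainTopBelow`, class (a′) «not monomially rational».

WHY THIS IS NOVEL: the first decided cell of the programme whose members are NOT rational function fields — a
law over a regular NON-monomial base (key-chain chart + sandwich) composed with the étale finite step; neither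
the toric/KH/Perron/key-chain ladders (all one-level, base monomial) nor the other five lenses' nodes (maximal-
contact tails, kangaroo towers, E1 tops, twisted/cross cuts — all on the CJS/hypersurface side) contain it.
WHY EACH PIECE IS STRICTLY WEAKER: every UNDECIDED piece is implied by the root by a kernel theorem
(`nonKHToricArchLUKeyHensel_of_root`, `whensel_of_root`; Π₁ and 0642 as before, `Theorems.PerronSigmaAscent`)
and none is known to imply it (the residual misses the decided cells I3, I3_ℓ, and now the AS-tops over them);
the DECIDED piece is a theorem.  Nothing here proves the summit; rung currency: rung 0, residual re-located.
-/

noncomputable section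

open IsLocalRing Literature.AlgebraicGeometry.Resolution
open Summit.ResolutionOfSingularities.ResolutionOfSingularities.Theorems
open Summit.ResolutionOfSingularities.ResolutionOfSingularities.Theorems.KeyChainLU

namespace Summit.ResolutionOfSingularities.ResolutionOfSingularities.Theorems.HenselKeyChainLU

section Engine

open Summit.ResolutionOfSingularities.ResolutionOfSingularities.Theses
open Summit.ResolutionOfSingularities.ResolutionOfSingularities.Theorems.PfaffLine
open Summit.ResolutionOfSingularities.ResolutionOfSingularities.Theorems.ToricLadder

variable {k K : Type} [Field k] [Field K] [Algebra k K]

/-! ## PART I — the ENGINE: a Hensel root over a relatively uniformizable finitely generated sub-top (§1) -/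

/-- **ENGINE (KK09 finite step over an arbitrary RelLU base).**  Let `F₁ ⊆ K` be a finitely generated
sub-top such that `O ∩ F₁` admits relative local uniformization over `k`, and let `K = F₁(η)` with `η ∈ O` a
HENSEL ROOT: `f(η) = 0` for a monic `f` with coefficients in `O ∩ F₁` and `v(f′(η)) = 0`.  Then `O` admits
relative local uniformization over `k`.  Proof = composition of LANDED theorems: `regularBase_of_relLU` (a
regular affine model of `O ∩ F₁` containing any prescribed finite set — here is where the base stops being
monomial), `isSmoothlyUniformizableIn_of_henselRoot` (Knaf–Kuhlmann 2009 Lemma 3.7: the layer `K | F₁` is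
smoothly uniformizable, standard-étale chart `O_{F₁}[X]/(f)` localised), `stub_relLU_of_regularBase` (KK09
Prop. 3.5 / Cor. 3.6: smooth over regular is regular, EGA IV 17.5.8).  No transcendental (Kaplansky) layer:
compare `KaplanskyLadder.relLU_of_khTop`, whose immediate layer `F₁(z) | F₁` is replaced here by NOTHING and
whose base RelLU came from a rung hypothesis, here from the key-chain LAW.
[KnafKuhlmann2009 = arXiv:math/0702856, Lemma 3.7, Prop. 3.5, Cor. 3.6] [folklore] -/
theorem relLU_of_henselTop (O : ValuationSubring K) (F₁ : IntermediateField k K) (hF₁fg : F₁.FG)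
    (hLU : RelLocalUniformization k F₁ (O.comap (algebraMap F₁ K))) (η : K) (hηO : η ∈ O)
    (hgen : Subfield.closure ((F₁.toSubfield : Set K) ∪ {η}) = ⊤)
    (f : Polynomial K) (hfmon : f.Monic) (hfcoeff : ∀ i, f.coeff i ∈ O ∧ f.coeff i ∈ F₁.toSubfield)
    (hfη : f.eval η = 0) (hfder : O.valuation ((Polynomial.derivative f).eval η) = 1) :
    RelLocalUniformization k K O := by
  classical
  intro R hR hfrac hRO
  have hk : ∀ c : k, algebraMap k K c ∈ O := algebraMap_mem_of_le O R hRO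
  haveI := hfrac
  have hkF₁ : (algebraMap k K).fieldRange ≤ F₁.toSubfield := by
    intro x hx
    obtain ⟨c, rfl⟩ := RingHom.mem_fieldRange.mp hx
    exact (IntermediateField.mem_toSubfield _ _).mpr (F₁.algebraMap_mem c)
  -- the REGULAR (non-monomial) base: an affine regular model of `O ∩ F₁` through any finite set
  have hB := regularBase_of_relLU O hk F₁ hF₁fg hLU
  -- the layer `K | F₁`: KK09 Lemma 3.7 (Hensel root ⇒ smoothly uniformizable over `O ∩ F₁`)
  have hF : ∀ Z : Finset K, (∀ z ∈ Z, z ∈ O) →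
      IsSmoothlyUniformizableIn ↥(O.toSubring ⊓ F₁.toSubfield.toSubring) O ⊤ (Z : Set K) :=
    fun Z hZ => isSmoothlyUniformizableIn_of_henselRoot O F₁.toSubfield ⊤ hηO hgen f hfmon hfcoeff hfη
      hfder (Z : Set K) (fun w hw => ⟨hZ w (Finset.mem_coe.mp hw), Subfield.mem_top w⟩)
  -- KK09 Prop. 3.5 / Cor. 3.6 over the regular base
  obtain ⟨A, h, hRA, hAfg, -, hreg⟩ :=
    stub_relLU_of_regularBase k K O hk F₁.toSubfield hkF₁ hB hF R hR hRO
  exact ⟨A, h, hRA, hAfg, hreg⟩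

end Engine

section Cell

variable (k : Type) [Field k] {K : Type} [Field K] [Algebra k K] (O : ValuationSubring K)

/-! ## PART II — the CELL `HenselKeyChainTopBelow` (rung `ι = 1` of the Henselian ladder) and its LAW (§2) -/

/-- **The decided cell** `HenselKeyChainTopBelow k O` (rung `ι = 1`): `K = F₁(η)` where `F₁ ⊆ K` is a
finitely generated sub-top whose trace `O ∩ F₁` carries an INDUCTIVE BINOMIAL KEY CHAIN over a monomial
`3`-frame (`KeyChainTopBelow`, g21 — so `F₁ = k(y₀, y₁, y₂, z)` is monomially rational) and `η ∈ O` is a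
HENSEL ROOT over `O ∩ F₁` generating `K`: the four Hensel clauses are VERBATIM those of
`KaplanskyLadder.KHTopBelow` with its Kaplansky layer `F₁(z)` replaced by `F₁` itself.  (`F₁.FG` is implied
by the key chain's `adjoin_eq_top`; it is kept so that the datum is syntactically `KHTopBelow`'s tail.)
Dictionary: `K ⊆ F₁^h` (K inside the henselisation of a key-chain sub-top) ⟺ `O_K` is ind-(local-étale) over
`O_{F₁}` ⟺ (structure of étale algebras, standard-étale presentation) the typed datum.
[KnafKuhlmann2009, Lemma 3.7; KnafKuhlmann2005, §5] -/
def HenselKeyChainTopBelow : Prop :=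
  ∃ (F₁ : IntermediateField k K) (η : K), F₁.FG ∧
    KeyChainTopBelow k (O.comap (algebraMap F₁ K)) ∧ η ∈ O ∧
    Subfield.closure ((F₁.toSubfield : Set K) ∪ {η}) = ⊤ ∧
    ∃ f : Polynomial K, f.Monic ∧ (∀ i, f.coeff i ∈ O ∧ f.coeff i ∈ F₁.toSubfield) ∧
      f.eval η = 0 ∧ O.valuation ((Polynomial.derivative f).eval η) = 1

variable {k O}

/-- **THE LAW (kernel): every Hensel top over a key-chain sub-top admits relative local uniformization.**
The g21 law `relLU_of_keyChainTop` uniformizes the base `(F₁, O ∩ F₁)`; the engine `relLU_of_henselTop`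
lifts it through the Hensel root. [KnafKuhlmann2009, Lemma 3.7, Prop. 3.5] [folklore] -/
theorem relLU_of_henselKeyChainTop (h : HenselKeyChainTopBelow k O) : RelLocalUniformization k K O := by
  obtain ⟨F₁, η, hfg, hkey, hηO, hgen, f, hfmon, hfcoeff, hfη, hfder⟩ := h
  exact relLU_of_henselTop O F₁ hfg (relLU_of_keyChainTop hkey) η hηO hgen f hfmon hfcoeff hfη hfder

end Cell

section ArtinSchreier

variable {k : Type} [Field k] {K : Type} [Field K] [Algebra k K] {O : ValuationSubring K}

/-! ## PART IIb — the ÉTALE ARTIN–SCHREIER sub-family of the cell (kernel; the inhabitant's Hensel clause) (§2b)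

Artin–Schreier tops `K = F₁(η)`, `η ^ p - η = a`, are THE characteristic-`p` layer over a key-chain sub-top `F₁`
(every ℤ/p-extension is of this form).  Kuhlmann's trichotomy by the position of `a` modulo `℘(F₁) = {b^p - b}`
[Kuhlmann2010 = Illinois J. Math. 54, «A classification of Artin–Schreier defect extensions», §§2–4]:
(E) `a` may be chosen INTEGRAL (`a ∈ O`) — then `f = X^p - X - a` has `f' ≡ -1`, `η` is a Hensel root, the `p`
extensions of `v|F₁` have `e = f = d = 1`: the top is IN THE CELL (`henselKeyChainTopBelow_of_artinSchreier`,
kernel, below); (R) `v(a) < 0` attained minimal in `a + ℘(F₁)` and `p ∤ v(a)` (or the residue side-conditions of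
loc. cit.) — DEFECTLESS, wildly ramified / inseparable-residue top, `ι = p`: RESIDUAL, tag UNDECIDED·IDEA-NEEDED;
(D) `sup v(a + ℘(F₁)) ` not attained — an Artin–Schreier DEFECT extension (`d = p`, immediate): RESIDUAL, tag
BARRIER/IDEA-NEEDED — THIS IS WHERE THE DEFECT SITS in the new residual `NonKHToricArchLUKeyHensel 3 3 4`:
immediate `ℤ/p`-tops (and towers of them) over NON-monomial two-level bases, invisible to every one-level cell. -/

/-- The Artin–Schreier polynomial `X ^ p - (X + C a)` is monic (`p` prime). [folklore] -/
theorem artinSchreier_monic {p : ℕ} (hp : p.Prime) (a : K) :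
    ((Polynomial.X : Polynomial K) ^ p - (Polynomial.X + Polynomial.C a)).Monic := by
  have h1 : (Polynomial.X + Polynomial.C a : Polynomial K).degree <
      ((Polynomial.X : Polynomial K) ^ p).degree := by
    rw [Polynomial.degree_X_pow]
    refine lt_of_le_of_lt (Polynomial.degree_add_le _ _) (max_lt ?_ ?_)
    · exact lt_of_le_of_lt Polynomial.degree_X_le (by exact_mod_cast hp.one_lt)
    · exact lt_of_le_of_lt Polynomial.degree_C_le (by exact_mod_cast hp.pos)
  exact (Polynomial.monic_X_pow p).sub_of_left h1

/-- Its coefficients lie in every subring containing `a`. [folklore] -/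
theorem artinSchreier_coeff_mem (p : ℕ) (a : K) (S : Subring K) (haS : a ∈ S) (i : ℕ) :
    ((Polynomial.X : Polynomial K) ^ p - (Polynomial.X + Polynomial.C a)).coeff i ∈ S := by
  simp only [Polynomial.coeff_sub, Polynomial.coeff_add, Polynomial.coeff_X_pow, Polynomial.coeff_X,
    Polynomial.coeff_C]
  refine sub_mem ?_ (add_mem ?_ ?_)
  · split_ifs
    exacts [one_mem S, zero_mem S]
  · split_ifs
    exacts [one_mem S, zero_mem S]
  · split_ifs
    exacts [haS, zero_mem S]

/-- `η` with `η ^ p - η = a` is a root. [folklore] -/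
theorem artinSchreier_eval {p : ℕ} {a η : K} (hAS : η ^ p - η = a) :
    ((Polynomial.X : Polynomial K) ^ p - (Polynomial.X + Polynomial.C a)).eval η = 0 := by
  simp only [Polynomial.eval_sub, Polynomial.eval_add, Polynomial.eval_pow, Polynomial.eval_X,
    Polynomial.eval_C, ← hAS]
  ring

/-- In characteristic `p` its derivative is identically `-1` (the extension is ÉTALE wherever `a` is
integral). [folklore] -/
theorem artinSchreier_derivative_eval (p : ℕ) [CharP K p] (a η : K) :
    (Polynomial.derivative ((Polynomial.X : Polynomial K) ^ p - (Polynomial.X + Polynomial.C a))).eval η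
      = -1 := by
  simp [Polynomial.derivative_X_pow]

/-- **ÉTALE ARTIN–SCHREIER TOPS over a key-chain sub-top lie in the Hensel cell** (kernel): if
`F₁ ⊆ K` is a finitely generated sub-top carrying a key chain, `η ∈ O` with `η ^ p - η = a`, `a ∈ O ∩ F₁`,
and `K = F₁(η)`, then `HenselKeyChainTopBelow k O` — hence `RelLocalUniformization k K O` by the law.  This is
the Hensel clause of the node's certified inhabitant (`F₁` = the I3_ℓ / I3 top, `a = x₁ ^ m`).
[Kuhlmann2010, §2; KnafKuhlmann2009, Lemma 3.7] [folklore] -/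
theorem henselKeyChainTopBelow_of_artinSchreier {p : ℕ} (hp : p.Prime) [CharP K p]
    (F₁ : IntermediateField k K) (hF₁fg : F₁.FG)
    (hkey : KeyChainTopBelow k (O.comap (algebraMap F₁ K))) (η a : K) (hηO : η ∈ O) (haO : a ∈ O)
    (haF : a ∈ F₁.toSubfield) (hAS : η ^ p - η = a)
    (hgen : Subfield.closure ((F₁.toSubfield : Set K) ∪ {η}) = ⊤) : HenselKeyChainTopBelow k O := by
  refine ⟨F₁, η, hF₁fg, hkey, hηO, hgen, Polynomial.X ^ p - (Polynomial.X + Polynomial.C a),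
    artinSchreier_monic hp a,
    fun i => ⟨artinSchreier_coeff_mem p a O.toSubring haO i,
      artinSchreier_coeff_mem p a F₁.toSubfield.toSubring haF i⟩,
    artinSchreier_eval hAS, ?_⟩
  rw [artinSchreier_derivative_eval p a η, Valuation.map_neg, map_one]

/-- … and are therefore relatively uniformizable (kernel). [folklore] -/
theorem relLU_of_artinSchreier_keyChainTop {p : ℕ} (hp : p.Prime) [CharP K p]
    (F₁ : IntermediateField k K) (hF₁fg : F₁.FG)
    (hkey : KeyChainTopBelow k (O.comap (algebraMap F₁ K))) (η a : K) (hηO : η ∈ O) (haO : a ∈ O)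
    (haF : a ∈ F₁.toSubfield) (hAS : η ^ p - η = a)
    (hgen : Subfield.closure ((F₁.toSubfield : Set K) ∪ {η}) = ⊤) : RelLocalUniformization k K O :=
  relLU_of_henselKeyChainTop
    (henselKeyChainTopBelow_of_artinSchreier hp F₁ hF₁fg hkey η a hηO haO haF hAS hgen)

end ArtinSchreier

section Cut

open Summit.ResolutionOfSingularities.ResolutionOfSingularities.Theses
open Summit.ResolutionOfSingularities.ResolutionOfSingularities.Theorems.PfaffLine
open Summit.ResolutionOfSingularities.ResolutionOfSingularities.Theorems.ToricLadder
open Summit.ResolutionOfSingularities.ResolutionOfSingularities.Theorems.KaplanskyLadder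
open Summit.ResolutionOfSingularities.ResolutionOfSingularities.Theorems.PerronLadder
open Summit.ResolutionOfSingularities.ResolutionOfSingularities.Theorems.DefectlessLadder
open Summit.ResolutionOfSingularities.ResolutionOfSingularities.Theorems.WCut

/-! ## PART III — the HENSEL CUT of the located residual and of its `W`-halves; ROOT BY NAME (§3) -/

/-- **DECIDED PIECE** (tag DECIDED — a kernel THEOREM, `nonKHToricArchLUKeyHenselCell_holds`; WEAKER than
the root; located at `(e, c, n) = (3, 3, 4)`): the located residual `NonKHToricArchLUKey e c n` restricted to
the Hensel cell (`ι = 1`). -/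
def NonKHToricArchLUKeyHenselCell (e c n : ℕ) : Prop :=
  ∀ p : ℕ, p.Prime → ∀ (k K : Type) [Field k] [CharP k p] [Field K] [Algebra k K],
    Algebra.trdeg k K ≤ n → ∀ O : ValuationSubring K, Nonempty O.valuation.RankOne →
    (∀ y ∈ O, ∃ f : Polynomial k, f ≠ 0 ∧ Polynomial.aeval y f ∈ O.nonunits) →
    ¬ IsAbhyankarPlace O (algebraMap k K).fieldRange ⊤ →
    ¬ (∃ d : ℕ, d < n ∧ SepDenseBelow k O d) → ¬ ToricDenseBelow k O e → ¬ KHTopBelow k O c →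
    ¬ KeyChainTopBelow k O → HenselKeyChainTopBelow k O → RelLocalUniformization k K O

/-- THE LAW DECIDES THE CELL PIECE outright, for all parameters (no port, no hypothesis). [folklore] -/
theorem nonKHToricArchLUKeyHenselCell_holds (e c n : ℕ) : NonKHToricArchLUKeyHenselCell e c n :=
  fun _ _ _ _ _ _ _ _ _ _ _ _ _ _ _ _ _ hH => relLU_of_henselKeyChainTop hH

/-- **NEW LOCATED RESIDUAL** (tag UNDECIDED · WEAKER than the root · located at `(e, c, n) = (3, 3, 4)`;
leaves: TAME rung `p ∤ ι` ATTACKABLE, WILD CORE `p ∣ ι` — defect over a non-monomial base — IDEA-NEEDED /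
BARRIER, direction (c) IDEA-NEEDED): the located residual OFF BOTH the key-chain cell and the Hensel cell,
i.e. the places of Henselian index `ι > 1` over every key-chain sub-top (and those with no key-chain sub-top
of finite index at all). -/
def NonKHToricArchLUKeyHensel (e c n : ℕ) : Prop :=
  ∀ p : ℕ, p.Prime → ∀ (k K : Type) [Field k] [CharP k p] [Field K] [Algebra k K],
    Algebra.trdeg k K ≤ n → ∀ O : ValuationSubring K, Nonempty O.valuation.RankOne →
    (∀ y ∈ O, ∃ f : Polynomial k, f ≠ 0 ∧ Polynomial.aeval y f ∈ O.nonunits) →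
    ¬ IsAbhyankarPlace O (algebraMap k K).fieldRange ⊤ →
    ¬ (∃ d : ℕ, d < n ∧ SepDenseBelow k O d) → ¬ ToricDenseBelow k O e → ¬ KHTopBelow k O c →
    ¬ KeyChainTopBelow k O → ¬ HenselKeyChainTopBelow k O → RelLocalUniformization k K O

/-- Dropping the extra negated hypothesis. [folklore] -/
theorem nonKHToricArchLUKeyHensel_of_key {e c n : ℕ} (h : NonKHToricArchLUKey e c n) :
    NonKHToricArchLUKeyHensel e c n :=
  fun p hp k K _ _ _ _ hd O h1 h0 hA hnd hnt hnk hkey _ => h p hp k K hd O h1 h0 hA hnd hnt hnk hkey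

/-- **THE HENSEL CUT** (kernel, exact): the located residual is EQUIVALENT to its part off the Hensel cell —
the part on the cell being the theorem `nonKHToricArchLUKeyHenselCell_holds`. [folklore] -/
theorem nonKHToricArchLUKey_iff_hensel {e c n : ℕ} :
    NonKHToricArchLUKey e c n ↔ NonKHToricArchLUKeyHensel e c n := by
  refine ⟨nonKHToricArchLUKeyHensel_of_key, fun h p hp k K _ _ _ _ hd O hr hz hA hnd hnt hnk hkey => ?_⟩
  by_cases hH : HenselKeyChainTopBelow k O
  · exact relLU_of_henselKeyChainTop hH
  · exact h p hp k K hd O hr hz hA hnd hnt hnk hkey hH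

/-- The same cut written as a conjunction «decided cell piece ∧ new residual». [folklore] -/
theorem nonKHToricArchLUKey_iff_henselCell_and_hensel {e c n : ℕ} :
    NonKHToricArchLUKey e c n ↔ NonKHToricArchLUKeyHenselCell e c n ∧ NonKHToricArchLUKeyHensel e c n :=
  ⟨fun h => ⟨nonKHToricArchLUKeyHenselCell_holds e c n, nonKHToricArchLUKeyHensel_of_key h⟩,
    fun h => nonKHToricArchLUKey_iff_hensel.2 h.2⟩

/-- The TRUE residual family of g17/g20 (`NonKHToricArchLU`) re-located in one step: off the key-chain cell AND
off the Hensel cell. [folklore] -/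
theorem nonKHToricArchLU_iff_hensel {e c n : ℕ} : NonKHToricArchLU e c n ↔ NonKHToricArchLUKeyHensel e c n :=
  nonKHToricArchLU_iff_key.trans nonKHToricArchLUKey_iff_hensel

/-- `W = 0` HALF OFF BOTH CELLS (tag UNDECIDED · WEAKER than the root). -/
def NonKHToricArchLUWZeroKeyHensel (e c n : ℕ) : Prop :=
  ∀ p : ℕ, p.Prime → ∀ (k K : Type) [Field k] [CharP k p] [Field K] [Algebra k K],
    Algebra.trdeg k K ≤ n → ∀ O : ValuationSubring K, Nonempty O.valuation.RankOne →
    (∀ y ∈ O, ∃ f : Polynomial k, f ≠ 0 ∧ Polynomial.aeval y f ∈ O.nonunits) →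
    ¬ IsAbhyankarPlace O (algebraMap k K).fieldRange ⊤ →
    ¬ (∃ d : ℕ, d < n ∧ SepDenseBelow k O d) → ¬ ToricDenseBelow k O e → ¬ KHTopBelow k O c →
    ¬ WNonzero k O → ¬ KeyChainTopBelow k O → ¬ HenselKeyChainTopBelow k O → RelLocalUniformization k K O

/-- `W ≠ 0` HALF OFF BOTH CELLS (tag UNDECIDED · WEAKER than the root). -/
def NonKHToricArchLUWPosKeyHensel (e c n : ℕ) : Prop :=
  ∀ p : ℕ, p.Prime → ∀ (k K : Type) [Field k] [CharP k p] [Field K] [Algebra k K],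
    Algebra.trdeg k K ≤ n → ∀ O : ValuationSubring K, Nonempty O.valuation.RankOne →
    (∀ y ∈ O, ∃ f : Polynomial k, f ≠ 0 ∧ Polynomial.aeval y f ∈ O.nonunits) →
    ¬ IsAbhyankarPlace O (algebraMap k K).fieldRange ⊤ →
    ¬ (∃ d : ℕ, d < n ∧ SepDenseBelow k O d) → ¬ ToricDenseBelow k O e → ¬ KHTopBelow k O c →
    WNonzero k O → ¬ KeyChainTopBelow k O → ¬ HenselKeyChainTopBelow k O → RelLocalUniformization k K O

/-- EXACT RE-LOCATION of the `W = 0` half. [folklore] -/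
theorem nonKHToricArchLUWZeroKey_iff_hensel {e c n : ℕ} :
    NonKHToricArchLUWZeroKey e c n ↔ NonKHToricArchLUWZeroKeyHensel e c n := by
  refine ⟨fun h p hp k K _ _ _ _ hd O hr hz hA hnd hnt hnk hW hkey _ =>
    h p hp k K hd O hr hz hA hnd hnt hnk hW hkey,
    fun h p hp k K _ _ _ _ hd O hr hz hA hnd hnt hnk hW hkey => ?_⟩
  by_cases hH : HenselKeyChainTopBelow k O
  · exact relLU_of_henselKeyChainTop hH
  · exact h p hp k K hd O hr hz hA hnd hnt hnk hW hkey hH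

/-- EXACT RE-LOCATION of the `W ≠ 0` half. [folklore] -/
theorem nonKHToricArchLUWPosKey_iff_hensel {e c n : ℕ} :
    NonKHToricArchLUWPosKey e c n ↔ NonKHToricArchLUWPosKeyHensel e c n := by
  refine ⟨fun h p hp k K _ _ _ _ hd O hr hz hA hnd hnt hnk hW hkey _ =>
    h p hp k K hd O hr hz hA hnd hnt hnk hW hkey,
    fun h p hp k K _ _ _ _ hd O hr hz hA hnd hnt hnk hW hkey => ?_⟩
  by_cases hH : HenselKeyChainTopBelow k O
  · exact relLU_of_henselKeyChainTop hH
  · exact h p hp k K hd O hr hz hA hnd hnt hnk hW hkey hH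

/-- The true residual as the conjunction of its two `W`-halves OFF BOTH CELLS. [folklore] -/
theorem nonKHToricArchLU_iff_whensel {e c n : ℕ} :
    NonKHToricArchLU e c n ↔ NonKHToricArchLUWZeroKeyHensel e c n ∧ NonKHToricArchLUWPosKeyHensel e c n := by
  rw [nonKHToricArchLU_iff_wkey, nonKHToricArchLUWZeroKey_iff_hensel, nonKHToricArchLUWPosKey_iff_hensel]

/-- The new residual follows from the root outright (it is a WEAKER piece). [folklore] -/
theorem nonKHToricArchLUKeyHensel_of_root (hS : _root_.ResolutionOfSingularities) (e c n : ℕ) :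
    NonKHToricArchLUKeyHensel e c n :=
  nonKHToricArchLUKeyHensel_of_key (nonKHToricArchLUKey_of_root hS e c n)

/-- Both `W`-halves off both cells follow from the root outright (WEAKER pieces). [folklore] -/
theorem whensel_of_root (hS : _root_.ResolutionOfSingularities) (e c n : ℕ) :
    NonKHToricArchLUWZeroKeyHensel e c n ∧ NonKHToricArchLUWPosKeyHensel e c n :=
  nonKHToricArchLU_iff_whensel.1 (nonKHToricArchLU_of_root hS e c n)

/-- **`closes_hensel` — ROOT BY NAME (deciding theorem of this node).**  Cossart–Piltant floor (print) +
CJS-2020 (named fact, tree) + the KK05 (NC)+(V) ascent Π₁ (print) + the located residual OFF THE KEY-CHAIN AND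
HENSEL CELLS in transcendence degree `≥ 4` + the patching crux 0642 ⇒ `ResolutionOfSingularities`; both cells
are discharged INSIDE the kernel (`relLU_of_keyChainTop`, `relLU_of_henselKeyChainTop`). [folklore] -/
theorem closes_hensel (hCP : CossartPiltant2019LU3.{0}) (hCJS : CossartJannsenSaito2020Embedded.{0})
    (hAsc : KK05NCVAscent) (hN : ∀ d, 4 ≤ d → NonKHToricArchLUKeyHensel 3 3 d)
    (h₃ : Valuative.PatchingRel) : _root_.ResolutionOfSingularities :=
  closes_key hCP hCJS hAsc (fun d hd => nonKHToricArchLUKey_iff_hensel.2 (hN d hd)) h₃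

/-- ROOT BY NAME, `W`-refined form: the two `W`-halves off both cells in place of the residual. [folklore] -/
theorem closes_whensel (hCP : CossartPiltant2019LU3.{0}) (hCJS : CossartJannsenSaito2020Embedded.{0})
    (hAsc : KK05NCVAscent) (hW₀ : ∀ d, 4 ≤ d → NonKHToricArchLUWZeroKeyHensel 3 3 d)
    (hW₁ : ∀ d, 4 ≤ d → NonKHToricArchLUWPosKeyHensel 3 3 d) (h₃ : Valuative.PatchingRel) :
    _root_.ResolutionOfSingularities :=
  closes_sigma hCP hCJS hAsc (fun d hd => nonKHToricArchLU_iff_whensel.2 ⟨hW₀ d hd, hW₁ d hd⟩) h₃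

/-- Root-level summary: modulo floor + CJS + Π₁ + 0642 the ROOT is EQUIVALENT to the residual family off
both cells (`root_iff_key_sigma` transported along the Hensel cut). [folklore] -/
theorem root_iff_hensel_sigma (hCP : CossartPiltant2019LU3.{0})
    (hCJS : CossartJannsenSaito2020Embedded.{0}) (hAsc : KK05NCVAscent) (h₃ : Valuative.PatchingRel) :
    _root_.ResolutionOfSingularities ↔ ∀ d, 4 ≤ d → NonKHToricArchLUKeyHensel 3 3 d := by
  rw [root_iff_key_sigma hCP hCJS hAsc h₃]
  exact forall₂_congr fun d _ => nonKHToricArchLUKey_iff_hensel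

end Cut

end Summit.ResolutionOfSingularities.ResolutionOfSingularities.Theorems.HenselKeyChainLU
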